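import Summits.ABC.IUTFork.Charitable.Thm311D1PerPlaceFineHull
import HarnessLib

/-!
# Branch D, team D1 — per-place square + Θ-pin ⊢ the HULL-LEVEL residual S_H for every PLACE-CERTIFIED equivariant region operator

Record file (D-0012; abc-iut cell, rung LADDER-ABC:A2.D; abc-iut-D1-prv gen 3): ONE structural predicate on a region-forming operator
(`PlaceCertified`, never asserted; the class-level form of p445135's place-separability of Kit III's `fineRegion`) and theorems. TAKES NO SIDE
on [IUTchIII] Cor. 3.12 or on any author; NO `Prop` fact.

WHAT IS DECIDED HERE (the hull-level analogue of p431983's `S_of_perPlace_of_local` / `S_of_perPlace_of_placewiseInvariant`). For the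
IDENTIFICATION-level residual S (abc-iut-w5-d230 `PilotKummerIndRelated`) the per-place square of (iii)(c) gives S only at placewise-invariant
or local-with-distinct-primes operators (p431983) and fails at vector-resolving ones even under the three pins (p440733, p444083). For the
HULL-level residual S_H (abc-iut-w5-d068 `PilotKummerCompatHull`: «ρ(qK) ⊆ ⁿ˒°𝒰_{j,v_ℚ}», the hull of the union of the possible images, Cor. 3.12
proof, S. Mochizuki, *Inter-universal Teichmüller theory III*, kurims (May 2020), p. 174 l. 50 – p. 175 l. 1) the picture is different:
**`pilotKummerCompatHull_of_perPlace_of_placeCertified`** — on ANY carrier, at ANY Cor. 3.12 setting, for ANY region operator that is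
(hρ)-equivariant and PLACE-CERTIFIED (every point of a region is certified by ONE bad place's datum: it lies in the region of every datum agreeing
with the given one at that place), the Θ-pin (pΘ) and the per-place square imply S_H. Reason: a point of `ρ(qK)` certified at `v` lies in
`ρ(Φ_v·frobΨ(m_v)) = Φ_v·ρ(frobΨ(m_v))`, a translate of a Θ-region, inside a possible image, inside the hull — the UNION over all indeterminacy
translates that the Corollary prescribes («the union of the possible images … subject to (Ind1), (Ind2), (Ind3)», p. 173 l. 49 – p. 174 l. 3)
absorbs place-dependent indeterminacies. Instances: Kit III's `fineRegion` is place-certified on every situation over the sign shells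
(`fineRegion_placeCertified`), recovering p445135's `fineSetting_pilotKummerCompatHull` as `fineSetting_pilotKummerCompatHull'`; with the
q-pin, S_H is the (xi-f) `Licence` (`licence_of_perPlace_of_placeCertified`), so the three pins + per-place square give `GapH3`'s conclusion
outright at such operators (`gapH3_of_perPlace_of_placeCertified`).
HONEST SCOPE: set-level and volume-free; `PlaceCertified` is a property of OUR binder `ρ` (as `LocalOverVQ`, `PlacewiseIndInvariant` of
p431983), not a print notion; whether print's q-pilot region former («the image of a q-pilot object», p. 174 l. 5–9, an arithmetic line bundle
in a tensor packet, Rmk. 3.9.5) is place-certified or couples the places over one `v_ℚ` is NOT decided here, and abc-iut-D-ref-2 (STATUS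
2026-08-26T12:24:50Z) reads the per-place quantifier shape itself as a relaxation below print's (Ind2)-per-`v_ℚ` granularity (p. 154
l. 55–61). Grades unchanged. [claim: Mochizuki2012, status: disputed] [cite: ScholzeStix2018, §2.2 pp. 9–10] Standard axioms; typed ≠ proved.
-/

noncomputable section

open Set

namespace Summit.ABC.IUTFork.Charitable

open Thm311 Cor312 Cor312Vol Literature.IUT.LogThetaLattice

variable {T : ThetaIndex} (S : LatticeSituation T) (P : Cor312.Setting S.toSituation)
  (ρ : (∀ v : T.V, v ∈ T.Vbad → Set (S.L.StarPacket v)) → ∀ (j : T.Label) (vQ : T.VQ), Set (S.L.Packet j vQ))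
  (qK : ∀ v : T.V, v ∈ T.Vbad → Set (S.L.StarPacket v))

/-! ## 1. Place-certified region operators -/

/-- **PLACE-CERTIFIED region operator** (structural property of PR-1's binder `ρ`, never asserted): every point of the region `ρ(X)` at a packet
`(j, v_ℚ)` is certified by ONE bad place `v` — it lies in `ρ(Y)` at `(j, v_ℚ)` for every datum `Y` that agrees with `X` at `v`. Region formers
that collect, place by place, vectors read off each place's datum (Kit III's `fineRegion`, §2) have it; formers coupling the data of two places
over one `v_ℚ` need not. [folklore] -/
def PlaceCertified : Prop :=
  ∀ (X : ∀ v : T.V, v ∈ T.Vbad → Set (S.L.StarPacket v)) (j : T.Label) (vQ : T.VQ), ∀ t ∈ ρ X j vQ,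
    ∃ (v : T.V) (hv : v ∈ T.Vbad), ∀ Y : ∀ v : T.V, v ∈ T.Vbad → Set (S.L.StarPacket v), Y v hv = X v hv → t ∈ ρ Y j vQ

/-- **Per-place square + Θ-pin ⊢ S_H at every place-certified equivariant operator** (any carrier, any setting, any q-datum): a point of
`ρ(qK)` certified at `v` lies in `ρ(Φ_v·frobΨ(m_v)) = Φ_v·ρ(frobΨ(m_v)) = Φ_v·(Θ-region of row m_v)`, inside a possible image, inside the
hull `ⁿ˒°𝒰_{j,v_ℚ}` (p445135 `pilotKummerCompatHull_of_subset_orbitUnion`). [claim: Mochizuki2012, status: disputed] -/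
theorem pilotKummerCompatHull_of_perPlace_of_placeCertified (hΘ : ThetaPinned S P ρ) (hcert : PlaceCertified S ρ)
    (hC : PerPlaceKummerCompat S P qK) : PilotKummerCompatHull S P ρ qK := by
  refine pilotKummerCompatHull_of_subset_orbitUnion S P ρ qK hΘ.2 fun j vQ t ht => ?_
  obtain ⟨v, hv, hY⟩ := hcert qK j vQ t ht
  obtain ⟨Φ, hΦ, m, hm⟩ := hC v hv
  refine Set.mem_iUnion₂.2 ⟨Φ, hΦ, Set.mem_iUnion.2 ⟨m, ?_⟩⟩
  rw [← hΘ.1 Φ hΦ ((S.col P.n).frobΨ m) j vQ]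
  exact hY _ hm.symm

/-- … hence, with the q-pin, the (xi-f) `Licence` (abc-iut-w5-d068 `licence_of_pilotKummerCompatHull`). [claim: Mochizuki2012, status: disputed] -/
theorem licence_of_perPlace_of_placeCertified (hpin : PinnedRegions S P ρ qK) (hcert : PlaceCertified S ρ)
    (hC : PerPlaceKummerCompat S P qK) : Thm311ToCor312.Licence P :=
  licence_of_pilotKummerCompatHull S P ρ qK hpin.2
    (pilotKummerCompatHull_of_perPlace_of_placeCertified S P ρ qK hpin.1 hcert hC)

/-- … so at a place-certified operator the per-place square yields the CONCLUSION of the hull-level gap `GapH3` (three pins ⟹ licence)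
outright. [claim: Mochizuki2012, status: disputed] -/
theorem gapH3_of_perPlace_of_placeCertified (hcert : PlaceCertified S ρ) (hC : PerPlaceKummerCompat S P qK) : GapH3 S P ρ qK :=
  fun hpin => licence_of_perPlace_of_placeCertified S P ρ qK hpin.1 hcert hC

/-- A PLACEWISE-INVARIANT operator (p431983) need not be place-certified, but there the per-place square already gives S itself
(`S_of_perPlace_of_placewiseInvariant`), and S gives S_H under the Θ-pin and (ii)(b) by abc-iut-w5-d068's chain BY NAME
(`pilotKummerCompatRegion_iff_pilotKummerIndRelated`, `pilotKummerCompatHull_of_region`) — composed here for the census. [folklore] -/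
theorem pilotKummerCompatHull_of_pilotKummerIndRelated (hΘ : ThetaPinned S P ρ) (hKumB : (S.col P.n).KummerB (S.D P.n))
    (hS : PilotKummerIndRelated S P ρ qK) : PilotKummerCompatHull S P ρ qK :=
  pilotKummerCompatHull_of_region S P ρ qK hΘ ((pilotKummerCompatRegion_iff_pilotKummerIndRelated S P ρ qK hKumB hΘ.1).2 hS)

/-! ## 2. Kit III's `fineRegion` is place-certified; p445135 recovered -/

/-- **`fineRegion` is place-certified** on every situation over the sign shells: at `j ≠ 0` a point carries the coordinates of ONE place's
datum element; at the zero label the operator returns everything. [folklore] -/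
theorem fineRegion_placeCertified :
    ∀ (X : ∀ v : T.V, v ∈ T.Vbad → Set ((NaiveProv.signShells T).StarPacket v)) (j : T.Label) (vQ : T.VQ), ∀ t ∈ fineRegion X j vQ,
      ∃ (v : T.V) (hv : v ∈ T.Vbad), ∀ Y : ∀ v : T.V, v ∈ T.Vbad → Set ((NaiveProv.signShells T).StarPacket v),
        Y v hv = X v hv → t ∈ fineRegion Y j vQ := by
  intro X j vQ t ht
  by_cases hj : j ≠ 0
  · obtain ⟨v, hv, hvQ, ψ, hψ, hc⟩ := (mem_fineRegion_iff hj).1 ht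
    refine ⟨v, hv, fun Y hY => (mem_fineRegion_iff hj).2 ⟨v, hv, hvQ, ψ, ?_, hc⟩⟩
    rw [hY]; exact hψ
  · have hj0 : j = 0 := not_not.mp hj
    subst hj0
    obtain ⟨v, hv⟩ := T.Vbad_nonempty
    refine ⟨v, hv, fun Y _ => ?_⟩
    rw [fineRegion_zero_label]; exact Set.mem_univ _

/-- `fineRegion` is place-certified in the sense of `PlaceCertified` at the fine situation of record (p444083 `fineFull1`). [folklore] -/
theorem fineRegion_placeCertified_fine (p : ℕ) (vQ₀ : T.VQ) (c : ℝ) :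
    PlaceCertified (fineFull1 p vQ₀ c).toLatticeSituation fineRegion :=
  fineRegion_placeCertified

/-- `fineRegion` is place-certified at the index-generic situation of record (w4-d026 `NaiveProv.full1`) too. [folklore] -/
theorem fineRegion_placeCertified_full1 (p : ℕ) (vQ₀ : T.VQ) (c : ℝ) :
    PlaceCertified (NaiveProv.full1 p vQ₀ c).toLatticeSituation fineRegion :=
  fineRegion_placeCertified

/-- **p445135 recovered from the class-level theorem**: S_H at the fine pinned model (per-place square p444083 `sepDatumSub_perPlace_fine`,
Θ-pin `fineSetting_thetaPinned`, place-certification). [folklore] -/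
theorem fineSetting_pilotKummerCompatHull' (p : ℕ) (v : T.V) (hv : v ∈ T.Vbad) (c : ℝ) (v' : T.V) :
    PilotKummerCompatHull (fineFull1 p (T.over v) c).toLatticeSituation (fineSetting p v hv c v') fineRegion (sepDatumSub p v v') :=
  pilotKummerCompatHull_of_perPlace_of_placeCertified _ _ _ _ (fineSetting_thetaPinned p v hv c v')
    (fineRegion_placeCertified_fine p (T.over v) c) (sepDatumSub_perPlace_fine p v hv c v')

end Summit.ABC.IUTFork.Charitable

end
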